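import Literature.NumberTheory.EllipticCurves.RationalOddNormLogTwoProofs
import HarnessLib

/-!
# The denominator of `x(2Q)` for a point with rational `x`-coordinate: `log₂ den x(2Q) =
# 4 log₂ den x(Q) + log₂ ψ₂²(x(Q))` under the receptacle's odd-prime conditions (proofs only)

Topic `Literature/NumberTheory/EllipticCurves` (trunk T-NT-EC). Pure proof file (no definition, no named
fact). Width seat `bsd-line-cf2-p1-w5` (g20) of the cell `bsd-print-cf2`, in support of
stmt-BirchSwinnertonDyer-20368 (road (C); the `d = ±2` boundary of the pinning stub
`stub_pin_minusTwist_two`, where the duplication law of the minus-twist height must be proved WITHOUT a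
`ℚ₂`-formal group containing the point). BSD is not proved by any of this.

The DENOMINATOR half of the duplication law `h(2P) = 4h(P)` for the receptacle
`canonicalPAdicHeightSqMinusTwist` (the sigma half is `SigmaSqInvXDuplicationProofs.lean`): for a rational
`x′ = x(Q)` (`Q` a point over any field, e.g. the minus part of a twist over `ℚ(√d)`) satisfying the
receptacle's odd-prime condition `HasNonsingularMinusReductionAt d ℓ x′` at every odd `ℓ`,
`log₂ den(Φ₂(x′)/ψ₂²(x′)) = 4·log₂ den x′ + log₂ ψ₂²(x′)` — Néron/Wuthrich's `e(2P) = e(P)⁴|ψ₂(P)|` at the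
odd primes, while at `2` nothing need be checked because `log₂` kills signs and powers of `2`.

* (prelude `RationalOddNormLogTwoProofs.lean`: `‖den q‖_ℓ = min(1, ‖q‖_ℓ⁻¹)`; rationals with equal
  `ℓ`-adic size at every odd prime have equal `log₂`);
* §1 `norm_Φ₂_ΨSq₂_of_one_lt` (leading terms for `‖x′‖_ℓ > 1`), `not_norm_Φ₂_ΨSq₂_lt_one` (**`Φ₂(x′)`,
  `ψ₂²(x′)` not both divisible by `ℓ`** at an `ℓ`-integral non-singular `x′`, via
  `16ψ₃ = 2(4f)(4f)″ − ((4f)′)²` and `Φ₂ = xψ₂² − ψ₃`), `norm_den_xDouble_eq` (the `ℓ`-adic law);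
* §2 `padicLog_den_xDouble` — the `log₂` statement.

## Sources

* B. Mazur, W. Stein, J. Tate, Doc. Math. Extra Vol. Coates (2006), §1 (denominators `d(P)` of points
  with everywhere non-singular reduction). [MazurSteinTate2006]
* J. H. Silverman, *The Arithmetic of Elliptic Curves*, 2nd ed. (2009), III.1, III.2.3(d), VII.2,
  VII.3.4, Exercise 3.7. [SilvermanAEC2009]
* K. Iwasawa, *Lectures on p-adic L-functions* (1972), §4.4. [Iwasawa1972PadicL]
-/

noncomputable section

open scoped Classical
open Literature.NumberTheory.EllipticCurves

namespace WeierstrassCurve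

/-! ### §1 `Φ₂(x′)` and `ψ₂²(x′)` at an odd prime -/

section Local

variable (V : WeierstrassCurve ℚ) [hV : V.IsIntegral ℤ] (ℓ : ℕ) [Fact ℓ.Prime]

/-- The `b`-invariants of a `ℤ`-integral equation are `ℓ`-adic integers. [folklore] -/
private theorem norm_b_le_one :
    ‖(V.b₂ : ℚ_[ℓ])‖ ≤ 1 ∧ ‖(V.b₄ : ℚ_[ℓ])‖ ≤ 1 ∧ ‖(V.b₆ : ℚ_[ℓ])‖ ≤ 1 ∧ ‖(V.b₈ : ℚ_[ℓ])‖ ≤ 1 := by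
  obtain ⟨V₀, hV₀⟩ := hV.integral
  have hb₂ : V.b₂ = (V₀.b₂ : ℚ) := by rw [hV₀]; simp [baseChange]
  have hb₄ : V.b₄ = (V₀.b₄ : ℚ) := by rw [hV₀]; simp [baseChange]
  have hb₆ : V.b₆ = (V₀.b₆ : ℚ) := by rw [hV₀]; simp [baseChange]
  have hb₈ : V.b₈ = (V₀.b₈ : ℚ) := by rw [hV₀]; simp [baseChange]
  refine ⟨?_, ?_, ?_, ?_⟩
  · rw [hb₂, Rat.cast_intCast]; exact Padic.norm_int_le_one _
  · rw [hb₄, Rat.cast_intCast]; exact Padic.norm_int_le_one _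
  · rw [hb₆, Rat.cast_intCast]; exact Padic.norm_int_le_one _
  · rw [hb₈, Rat.cast_intCast]; exact Padic.norm_int_le_one _

/-- `‖4‖_ℓ = 1 = ‖2‖_ℓ`, `‖16‖_ℓ ≤ 1`, `‖24‖_ℓ ≤ 1` at an odd prime `ℓ` (private plumbing). [folklore] -/
private theorem norm_two_four (hℓ2 : ℓ ≠ 2) : ‖(2 : ℚ_[ℓ])‖ = 1 ∧ ‖(4 : ℚ_[ℓ])‖ = 1 := by
  have hℓ : ℓ.Prime := Fact.out
  have h2 : ‖(2 : ℚ_[ℓ])‖ = 1 := by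
    have hle : ‖(2 : ℚ_[ℓ])‖ ≤ 1 := by exact_mod_cast Padic.norm_int_le_one (p := ℓ) 2
    refine le_antisymm hle (not_lt.mp fun hlt => hℓ2 ?_)
    have : ℓ ∣ 2 := by
      rw [show (2 : ℚ_[ℓ]) = ((2 : ℕ) : ℚ_[ℓ]) by norm_num, Padic.norm_natCast_lt_one_iff] at hlt; exact hlt
    exact (Nat.prime_dvd_prime_iff_eq hℓ Nat.prime_two).mp this
  exact ⟨h2, by rw [show (4 : ℚ_[ℓ]) = 2 * 2 by norm_num, norm_mul, h2, one_mul]⟩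

/-- **`‖Φ₂(x′)‖_ℓ = ‖x′‖_ℓ⁴` and `‖ψ₂²(x′)‖_ℓ = ‖x′‖_ℓ³` when `‖x′‖_ℓ > 1`** (`ℓ` odd, `ℤ`-integral
equation): the leading terms dominate. [Silverman AEC VII.2 (reduction of `x(2P)`), Exercise 3.7]
[cite: SilvermanAEC2009, Exercise 3.7] -/
theorem norm_Φ₂_ΨSq₂_of_one_lt (hℓ2 : ℓ ≠ 2) {x' : ℚ} (hx : 1 < ‖(x' : ℚ_[ℓ])‖) :
    ‖((x' ^ 4 - V.b₄ * x' ^ 2 - 2 * V.b₆ * x' - V.b₈ : ℚ) : ℚ_[ℓ])‖ = ‖(x' : ℚ_[ℓ])‖ ^ 4 ∧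
      ‖((4 * x' ^ 3 + V.b₂ * x' ^ 2 + 2 * V.b₄ * x' + V.b₆ : ℚ) : ℚ_[ℓ])‖ = ‖(x' : ℚ_[ℓ])‖ ^ 3 := by
  obtain ⟨h₂, h₄, h₆, h₈⟩ := norm_b_le_one V ℓ
  obtain ⟨n2, n4⟩ := norm_two_four ℓ hℓ2
  set u := ‖(x' : ℚ_[ℓ])‖ with hu
  have hu0 : 0 < u := one_pos.trans hx
  have hu1 : 1 ≤ u := hx.le
  -- tails
  have htailA : ‖((V.b₄ : ℚ_[ℓ]) * (x' : ℚ_[ℓ]) ^ 2 + 2 * V.b₆ * x' + V.b₈)‖ ≤ u ^ 2 := by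
    refine (Padic.nonarchimedean _ _).trans (max_le ((Padic.nonarchimedean _ _).trans (max_le ?_ ?_)) ?_)
    · rw [norm_mul, norm_pow]; exact mul_le_of_le_one_left (pow_nonneg hu0.le 2) h₄
    · rw [norm_mul, norm_mul, n2, one_mul]
      calc ‖(V.b₆ : ℚ_[ℓ])‖ * u ≤ 1 * u := mul_le_mul_of_nonneg_right h₆ hu0.le
        _ ≤ u ^ 2 := by rw [one_mul, sq]; exact le_mul_of_one_le_left hu0.le hu1
    · exact h₈.trans (one_le_pow₀ hu1)
  have htailB : ‖((V.b₂ : ℚ_[ℓ]) * (x' : ℚ_[ℓ]) ^ 2 + 2 * V.b₄ * x' + V.b₆)‖ ≤ u ^ 2 := by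
    refine (Padic.nonarchimedean _ _).trans (max_le ((Padic.nonarchimedean _ _).trans (max_le ?_ ?_)) ?_)
    · rw [norm_mul, norm_pow]; exact mul_le_of_le_one_left (pow_nonneg hu0.le 2) h₂
    · rw [norm_mul, norm_mul, n2, one_mul]
      calc ‖(V.b₄ : ℚ_[ℓ])‖ * u ≤ 1 * u := mul_le_mul_of_nonneg_right h₄ hu0.le
        _ ≤ u ^ 2 := by rw [one_mul, sq]; exact le_mul_of_one_le_left hu0.le hu1
    · exact h₆.trans (one_le_pow₀ hu1)
  have hlt2 : u ^ 2 < u ^ 3 := pow_lt_pow_right₀ hx (by norm_num)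
  have hlt3 : u ^ 2 < u ^ 4 := pow_lt_pow_right₀ hx (by norm_num)
  constructor
  · have hlead : ‖(x' : ℚ_[ℓ]) ^ 4‖ = u ^ 4 := by rw [norm_pow]
    have hne : ‖(x' : ℚ_[ℓ]) ^ 4‖ ≠ ‖-((V.b₄ : ℚ_[ℓ]) * (x' : ℚ_[ℓ]) ^ 2 + 2 * V.b₆ * x' + V.b₈)‖ := by
      rw [hlead, norm_neg]; exact (ne_of_gt (htailA.trans_lt hlt3))
    have := Padic.add_eq_max_of_ne hne
    rw [hlead, norm_neg, max_eq_left (htailA.trans hlt3.le)] at this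
    push_cast
    rw [show ((x' : ℚ_[ℓ]) ^ 4 - V.b₄ * x' ^ 2 - 2 * V.b₆ * x' - V.b₈) =
      (x' : ℚ_[ℓ]) ^ 4 + -((V.b₄ : ℚ_[ℓ]) * (x' : ℚ_[ℓ]) ^ 2 + 2 * V.b₆ * x' + V.b₈) by ring]
    exact this
  · have hlead : ‖(4 : ℚ_[ℓ]) * (x' : ℚ_[ℓ]) ^ 3‖ = u ^ 3 := by rw [norm_mul, norm_pow, n4, one_mul]
    have hne : ‖(4 : ℚ_[ℓ]) * (x' : ℚ_[ℓ]) ^ 3‖ ≠ ‖((V.b₂ : ℚ_[ℓ]) * (x' : ℚ_[ℓ]) ^ 2 + 2 * V.b₄ * x' + V.b₆)‖ := by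
      rw [hlead]; exact (ne_of_gt (htailB.trans_lt hlt2))
    have := Padic.add_eq_max_of_ne hne
    rw [hlead, max_eq_left (htailB.trans hlt2.le)] at this
    push_cast
    rw [show ((4 : ℚ_[ℓ]) * (x' : ℚ_[ℓ]) ^ 3 + V.b₂ * x' ^ 2 + 2 * V.b₄ * x' + V.b₆) =
      (4 : ℚ_[ℓ]) * (x' : ℚ_[ℓ]) ^ 3 + ((V.b₂ : ℚ_[ℓ]) * (x' : ℚ_[ℓ]) ^ 2 + 2 * V.b₄ * x' + V.b₆) by ring]
    exact this

/-- **`Φ₂(x′)` and `ψ₂²(x′)` are not both divisible by an odd prime `ℓ` at an `ℓ`-integral `x′`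
satisfying the receptacle's condition `HasNonsingularMinusReductionAt`** (non-singular reduction of the
point with `x`-coordinate `x′`): a common zero of `ψ₂² = 4f` and `Φ₂ = xψ₂² − ψ₃` modulo `ℓ` is a zero of
`16ψ₃ = 2(4f)(4f)″ − ((4f)′)²`, hence of `f′` — a singular point. [Silverman AEC III.1 (singular points),
VII.2, Exercise 3.7] [cite: SilvermanAEC2009, Exercise 3.7] -/
theorem not_norm_Φ₂_ΨSq₂_lt_one (hℓ2 : ℓ ≠ 2) {d x' : ℚ} (hx : ‖(x' : ℚ_[ℓ])‖ ≤ 1)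
    (hns : V.HasNonsingularMinusReductionAt d ℓ x') :
    ¬ (‖((x' ^ 4 - V.b₄ * x' ^ 2 - 2 * V.b₆ * x' - V.b₈ : ℚ) : ℚ_[ℓ])‖ < 1 ∧
      ‖((4 * x' ^ 3 + V.b₂ * x' ^ 2 + 2 * V.b₄ * x' + V.b₆ : ℚ) : ℚ_[ℓ])‖ < 1) := by
  obtain ⟨h₂, h₄, h₆, h₈⟩ := norm_b_le_one V ℓ
  obtain ⟨n2, n4⟩ := norm_two_four ℓ hℓ2
  rintro ⟨hA, hB⟩
  simp only [HasNonsingularMinusReductionAt] at hns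
  rcases hns with hlt | ⟨hf'0, hf'v⟩ | ⟨-, hf0, hfv⟩
  · exact absurd hx (not_le.mpr ((one_lt_norm_ratCast_iff ℓ x').mpr hlt))
  · -- `f′(x′)` is an `ℓ`-unit; but `(4f′)² = 2·B·B″ − 16(x′B − A)` is small
    have hf' : ‖((3 * x' ^ 2 + V.b₂ / 2 * x' + V.b₄ / 2 : ℚ) : ℚ_[ℓ])‖ = 1 :=
      (norm_ratCast_eq_one_iff ℓ _).mpr ⟨hf'0, hf'v⟩
    have hb := V.b_relation
    have hid : ((4 * (3 * x' ^ 2 + V.b₂ / 2 * x' + V.b₄ / 2) : ℚ)) ^ 2 =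
        2 * (4 * x' ^ 3 + V.b₂ * x' ^ 2 + 2 * V.b₄ * x' + V.b₆) * (24 * x' + 2 * V.b₂) -
          16 * (x' * (4 * x' ^ 3 + V.b₂ * x' ^ 2 + 2 * V.b₄ * x' + V.b₆) -
            (x' ^ 4 - V.b₄ * x' ^ 2 - 2 * V.b₆ * x' - V.b₈)) := by
      linear_combination 4 * hb
    have hid' : ‖(((4 * (3 * x' ^ 2 + V.b₂ / 2 * x' + V.b₄ / 2) : ℚ) ^ 2 : ℚ) : ℚ_[ℓ])‖ =
        ‖((2 * (4 * x' ^ 3 + V.b₂ * x' ^ 2 + 2 * V.b₄ * x' + V.b₆) * (24 * x' + 2 * V.b₂) -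
          16 * (x' * (4 * x' ^ 3 + V.b₂ * x' ^ 2 + 2 * V.b₄ * x' + V.b₆) -
            (x' ^ 4 - V.b₄ * x' ^ 2 - 2 * V.b₆ * x' - V.b₈)) : ℚ) : ℚ_[ℓ])‖ := by rw [hid]
    have hL : ‖(((4 * (3 * x' ^ 2 + V.b₂ / 2 * x' + V.b₄ / 2) : ℚ)) : ℚ_[ℓ]) ^ 2‖ = 1 := by
      push_cast [Rat.cast_pow] at hf' ⊢
      rw [norm_pow, norm_mul, n4, one_mul, hf', one_pow]
    have hR : ‖((2 * (4 * x' ^ 3 + V.b₂ * x' ^ 2 + 2 * V.b₄ * x' + V.b₆) * (24 * x' + 2 * V.b₂) -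
          16 * (x' * (4 * x' ^ 3 + V.b₂ * x' ^ 2 + 2 * V.b₄ * x' + V.b₆) -
            (x' ^ 4 - V.b₄ * x' ^ 2 - 2 * V.b₆ * x' - V.b₈)) : ℚ) : ℚ_[ℓ])‖ < 1 := by
      have h24 : ‖((24 * x' + 2 * V.b₂ : ℚ) : ℚ_[ℓ])‖ ≤ 1 := by
        push_cast
        refine (Padic.nonarchimedean _ _).trans (max_le ?_ ?_)
        · rw [norm_mul]
          exact mul_le_one₀ (by exact_mod_cast Padic.norm_int_le_one (p := ℓ) 24) (norm_nonneg _) hx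
        · rw [norm_mul, n2, one_mul]; exact h₂
      have h16 : ‖((16 : ℚ) : ℚ_[ℓ])‖ ≤ 1 := by exact_mod_cast Padic.norm_int_le_one (p := ℓ) 16
      rw [Rat.cast_sub, sub_eq_add_neg]
      refine (Padic.nonarchimedean _ _).trans_lt (max_lt ?_ ?_)
      · rw [Rat.cast_mul, Rat.cast_mul, norm_mul, norm_mul, Rat.cast_ofNat, n2, one_mul]
        exact mul_lt_one_of_nonneg_of_lt_one_left (norm_nonneg _) hB h24
      · rw [norm_neg, Rat.cast_mul, norm_mul, Rat.cast_sub, sub_eq_add_neg]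
        refine lt_of_le_of_lt (mul_le_of_le_one_left (norm_nonneg _) h16) ?_
        refine (Padic.nonarchimedean _ _).trans_lt (max_lt ?_ ?_)
        · rw [Rat.cast_mul, norm_mul]
          exact mul_lt_one_of_nonneg_of_lt_one_right hx (norm_nonneg _) hB
        · rw [norm_neg]; exact hA
    rw [Rat.cast_pow] at hid'
    rw [hid'] at hL
    exact absurd hL (ne_of_lt hR)
  · -- `f(x′)` is an `ℓ`-unit, `B = 4f`
    have hf : ‖((x' ^ 3 + V.b₂ / 4 * x' ^ 2 + V.b₄ / 2 * x' + V.b₆ / 4 : ℚ) : ℚ_[ℓ])‖ = 1 :=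
      (norm_ratCast_eq_one_iff ℓ _).mpr ⟨hf0, hfv⟩
    have : ((4 * x' ^ 3 + V.b₂ * x' ^ 2 + 2 * V.b₄ * x' + V.b₆ : ℚ)) =
        4 * (x' ^ 3 + V.b₂ / 4 * x' ^ 2 + V.b₄ / 2 * x' + V.b₆ / 4) := by ring
    rw [this, Rat.cast_mul, norm_mul, Rat.cast_ofNat, n4, one_mul, hf] at hB
    exact lt_irrefl _ hB

/-- **The `ℓ`-adic denominator law for `x(2Q) = Φ₂(x′)/ψ₂²(x′)` at an odd prime**: under the receptacle's
condition at `ℓ`, `‖den x(2Q)‖_ℓ = ‖den x′‖_ℓ⁴ · ‖ψ₂²(x′)‖_ℓ` (`e(2P) = e(P)⁴|ψ₂(P)|` for a point with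
non-singular reduction, prime by prime). [Wuthrich 2004 / Mazur–Stein–Tate 2006, §1 (denominators of
multiples); Silverman AEC Exercise 3.7] [cite: MazurSteinTate2006, §1] [cite: SilvermanAEC2009, Exercise 3.7] -/
theorem norm_den_xDouble_eq (hℓ2 : ℓ ≠ 2) {d x' : ℚ} (hns : V.HasNonsingularMinusReductionAt d ℓ x')
    (hB : (4 * x' ^ 3 + V.b₂ * x' ^ 2 + 2 * V.b₄ * x' + V.b₆ : ℚ) ≠ 0) :
    ‖((((x' ^ 4 - V.b₄ * x' ^ 2 - 2 * V.b₆ * x' - V.b₈) /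
          (4 * x' ^ 3 + V.b₂ * x' ^ 2 + 2 * V.b₄ * x' + V.b₆) : ℚ).den : ℚ) : ℚ_[ℓ])‖ =
      ‖((x'.den : ℚ) : ℚ_[ℓ])‖ ^ 4 * ‖((4 * x' ^ 3 + V.b₂ * x' ^ 2 + 2 * V.b₄ * x' + V.b₆ : ℚ) : ℚ_[ℓ])‖ := by
  obtain ⟨h₂, h₄, h₆, h₈⟩ := norm_b_le_one V ℓ
  obtain ⟨n2, n4⟩ := norm_two_four ℓ hℓ2
  set A : ℚ := x' ^ 4 - V.b₄ * x' ^ 2 - 2 * V.b₆ * x' - V.b₈ with hAdef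
  set B : ℚ := 4 * x' ^ 3 + V.b₂ * x' ^ 2 + 2 * V.b₄ * x' + V.b₆ with hBdef
  have hB0' : ((B : ℚ) : ℚ_[ℓ]) ≠ 0 := by exact_mod_cast hB
  by_cases hx : 1 < ‖(x' : ℚ_[ℓ])‖
  · -- `‖x′‖ > 1`: `‖A‖ = u⁴`, `‖B‖ = u³`, both sides `= u⁻¹`
    obtain ⟨hAn, hBn⟩ := V.norm_Φ₂_ΨSq₂_of_one_lt ℓ hℓ2 hx
    rw [← hAdef] at hAn; rw [← hBdef] at hBn
    have hx0 : x' ≠ 0 := by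
      rintro rfl; rw [Rat.cast_zero, norm_zero] at hx; exact not_lt.mpr zero_le_one hx
    set u := ‖(x' : ℚ_[ℓ])‖ with hu
    have hu0 : 0 < u := one_pos.trans hx
    have hA0 : A ≠ 0 := by
      intro h; rw [h, Rat.cast_zero, norm_zero] at hAn; exact pow_ne_zero 4 hu0.ne' hAn.symm
    have hq0 : A / B ≠ 0 := div_ne_zero hA0 hB
    rw [norm_ratCast_den_eq ℓ hq0, norm_ratCast_den_eq ℓ hx0, Rat.cast_div, norm_div, hAn, hBn, ← hu]
    have h1 : (u ^ 4 / u ^ 3)⁻¹ = u⁻¹ := by field_simp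
    rw [h1, min_eq_right (inv_le_one_of_one_le₀ hx.le)]
    field_simp
  · -- `‖x′‖ ≤ 1`: `den x′` is an `ℓ`-unit, and `A`, `B` are not both non-units
    rw [not_lt] at hx
    have hnot := V.not_norm_Φ₂_ΨSq₂_lt_one ℓ hℓ2 hx hns
    rw [← hAdef, ← hBdef] at hnot
    have hden1 : ‖((x'.den : ℚ) : ℚ_[ℓ])‖ = 1 := by
      by_cases hx0 : x' = 0
      · rw [hx0]; simp
      · rw [norm_ratCast_den_eq ℓ hx0, min_eq_left]
        exact one_le_inv_iff₀.mpr ⟨norm_pos_iff.mpr (by exact_mod_cast hx0), hx⟩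
    have hAle : ‖((A : ℚ) : ℚ_[ℓ])‖ ≤ 1 := by
      rw [hAdef]; push_cast
      rw [sub_eq_add_neg, sub_eq_add_neg, sub_eq_add_neg]
      refine (Padic.nonarchimedean _ _).trans (max_le ((Padic.nonarchimedean _ _).trans
        (max_le ((Padic.nonarchimedean _ _).trans (max_le ?_ ?_)) ?_)) ?_)
      · rw [norm_pow]; exact pow_le_one₀ (norm_nonneg _) hx
      · rw [norm_neg, norm_mul, norm_pow]
        exact mul_le_one₀ h₄ (pow_nonneg (norm_nonneg _) 2) (pow_le_one₀ (norm_nonneg _) hx)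
      · rw [norm_neg, norm_mul, norm_mul, n2, one_mul]; exact mul_le_one₀ h₆ (norm_nonneg _) hx
      · rw [norm_neg]; exact h₈
    have hBle : ‖((B : ℚ) : ℚ_[ℓ])‖ ≤ 1 := by
      rw [hBdef]; push_cast
      refine (Padic.nonarchimedean _ _).trans (max_le ((Padic.nonarchimedean _ _).trans
        (max_le ((Padic.nonarchimedean _ _).trans (max_le ?_ ?_)) ?_)) ?_)
      · rw [norm_mul, n4, one_mul, norm_pow]; exact pow_le_one₀ (norm_nonneg _) hx
      · rw [norm_mul, norm_pow]
        exact mul_le_one₀ h₂ (pow_nonneg (norm_nonneg _) 2) (pow_le_one₀ (norm_nonneg _) hx)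
      · rw [norm_mul, norm_mul, n2, one_mul]; exact mul_le_one₀ h₄ (norm_nonneg _) hx
      · exact h₆
    rw [hden1, one_pow, one_mul]
    by_cases hA0 : A = 0
    · -- `A = 0`: `x(2Q) = 0`, denominator `1`; and `‖B‖ = 1`
      have hB1 : ‖((B : ℚ) : ℚ_[ℓ])‖ = 1 := by
        refine le_antisymm hBle (not_lt.mp fun hlt => hnot ⟨?_, hlt⟩)
        rw [hA0, Rat.cast_zero, norm_zero]; exact one_pos
      rw [hA0, zero_div, hB1]; simp
    have hq0 : A / B ≠ 0 := div_ne_zero hA0 hB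
    rw [norm_ratCast_den_eq ℓ hq0, Rat.cast_div, norm_div, inv_div]
    by_cases hA1 : ‖((A : ℚ) : ℚ_[ℓ])‖ < 1
    · have hB1 : ‖((B : ℚ) : ℚ_[ℓ])‖ = 1 := le_antisymm hBle (not_lt.mp fun hlt => hnot ⟨hA1, hlt⟩)
      rw [hB1, min_eq_left]
      exact (one_le_div (norm_pos_iff.mpr (by exact_mod_cast hA0))).mpr hA1.le
    · have hA1' : ‖((A : ℚ) : ℚ_[ℓ])‖ = 1 := le_antisymm hAle (not_lt.mp hA1)
      rw [hA1', div_one, min_eq_right hBle]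

end Local

/-! ### §2 The `2`-adic logarithm of the denominator of `x(2Q)` -/

section Global

variable (V : WeierstrassCurve ℚ) [V.IsIntegral ℤ]

/-- **`log₂ den x(2Q) = 4·log₂ den x(Q) + log₂ ψ₂²(x(Q))`** for a rational `x′ = x(Q)` satisfying the
receptacle's non-singularity condition `HasNonsingularMinusReductionAt d ℓ x′` at every odd prime `ℓ`
(`x(2Q) = Φ₂(x′)/ψ₂²(x′)`): the two sides have the same `ℓ`-adic size at every odd `ℓ`
(`norm_den_xDouble_eq`), and `log₂` does not see signs and powers of `2`. Valid for points `Q` over any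
field with rational `x(Q)` — in particular on the minus part of a quadratic twist, where no `ℚ₂`-model
has `Q` in its formal group. [Mazur–Stein–Tate 2006, §1; Silverman AEC Exercise 3.7]
[cite: MazurSteinTate2006, §1] [cite: SilvermanAEC2009, Exercise 3.7] -/
theorem padicLog_den_xDouble {d x' : ℚ}
    (hmin : ∀ ℓ : ℕ, ℓ.Prime → ℓ ≠ 2 → V.HasNonsingularMinusReductionAt d ℓ x')
    (hB : (4 * x' ^ 3 + V.b₂ * x' ^ 2 + 2 * V.b₄ * x' + V.b₆ : ℚ) ≠ 0) :
    padicLog 2 ((((x' ^ 4 - V.b₄ * x' ^ 2 - 2 * V.b₆ * x' - V.b₈) /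
          (4 * x' ^ 3 + V.b₂ * x' ^ 2 + 2 * V.b₄ * x' + V.b₆) : ℚ).den : ℚ) : ℚ_[2]) =
      4 * padicLog 2 ((x'.den : ℚ) : ℚ_[2]) +
        padicLog 2 ((4 * x' ^ 3 + V.b₂ * x' ^ 2 + 2 * V.b₄ * x' + V.b₆ : ℚ) : ℚ_[2]) := by
  have hmul : padicLog_mul 2 := padicLog_mul_holds 2
  set B : ℚ := 4 * x' ^ 3 + V.b₂ * x' ^ 2 + 2 * V.b₄ * x' + V.b₆ with hBdef
  set q : ℚ := (x' ^ 4 - V.b₄ * x' ^ 2 - 2 * V.b₆ * x' - V.b₈) / B with hqdef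
  have hden0 : (x'.den : ℚ) ≠ 0 := by exact_mod_cast x'.den_nz
  have hs : (x'.den : ℚ) ^ 4 * B ≠ 0 := mul_ne_zero (pow_ne_zero 4 hden0) hB
  have hr : (q.den : ℚ) ≠ 0 := by exact_mod_cast q.den_nz
  have key := padicLog_two_eq_of_norm_eq_odd hr hs fun ℓ _ hℓ2 => by
    rw [V.norm_den_xDouble_eq ℓ hℓ2 (hmin ℓ Fact.out hℓ2) hB, Rat.cast_mul, Rat.cast_pow, norm_mul, norm_pow]
  rw [key, Rat.cast_mul, Rat.cast_pow, hmul (pow_ne_zero 4 (by exact_mod_cast hden0)) (by exact_mod_cast hB),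
    show ((x'.den : ℚ) : ℚ_[2]) ^ 4 = (((x'.den : ℚ) : ℚ_[2]) ^ 2) ^ 2 by ring,
    padicLog_sq (pow_ne_zero 2 (by exact_mod_cast hden0)), padicLog_sq (by exact_mod_cast hden0)]
  ring

end Global

end WeierstrassCurve
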